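import Summits.BirchSwinnertonDyer.Rank1Residual.ManinAdditive.DegeneracyLoopLaws
import Summits.BirchSwinnertonDyer.BirchSwinnertonDyer.Theorems.ManinLocalTwoThreeRowSymbol
import HarnessLib
import HarnessLib.Audit.Tags

/-!
# The degeneracy-loop laws E-es-68₉ / E-es-68₈ REDUCED to an elementary connectivity statement about integer
# rows (route `ManinLocalTwoThree`, cell bsd-f2-manin; cruxes C3 `ManinPrimeToThreeAtNine` stmt-BirchSwinnertonDyer-22968,
# C2 `ManinOddAtFour` stmt-BirchSwinnertonDyer-22967; prover seat p3 gen 10 — helper, unconditional)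

The cell's law E-es-68 (`Summit.BirchSwinnertonDyer.Rank1Residual.ManinAdditive.Gamma1Lattice.DegeneracyLoopLaw t`,
rows E-es-68₉ `DegeneracyLoopLawNine` at `9 ∣ N` and E-es-68₈ `DegeneracyLoopLawEight` at `4 ∣ N`, typed in
`…/ManinAdditive/DegeneracyLoopLaws.lean`; its easy half `closure_degeneracyLoops_le` is proved there) says that for
every `f ∈ S₂(Γ₀(N))` the degeneracy loops `{∞, t·b/m}_f − {∞, b/m}_f` (`m` prime, `m ∤ tN`, `m ∤ b`) generate the
`Γ₁(N)`-period lattice `Λ₁(f)`; homologically it is the Ribet–Ihara equaliser `ker(B₁^* − B_t^*) ∩ J₀(N)_tors = Σ(N)`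
at `t ∣ N` (in print only for `t` prime to `N`, Ribet 1984).  It is the residual law of the squarefull habitat of C3/C2
(`threeAdicPolarWitness_squarefull_of_degeneracyLoopLawNine′`, `twoAdicPolarWitness_of_degeneracyLoopLawEight`).

THIS FILE proves, for every level `N ≥ 2`, every `t ≥ 1` and every `f`, that the law FOLLOWS from a statement about
pairs of integers in which no modular form, no group and no curve appears:

* **row moves** (`rowMoves N t`, on rows `(c, d) ∈ ℤ²` with `N ∣ c`, `gcd(c, d) = 1` — `rowValid N`):
  `(c, d) → (c + N k d, d)`, `(c, d) → (c, d + k c)`, `(c, d) → (−c, −d)` and `(t c, d) → (c, d)`;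
* **row-move connectivity at `(N, t)`**: every valid row with `d ≡ ±1 (mod N)` is joined to `(0, 1)` by row moves and
  their inverses (`Relation.EqvGen`); the two rows that matter are typed as `@[conjecture]` nodes `RowMoveLawNine`
  (E-p3-Q₉, `t = 9` at `9 ∣ N`) and `RowMoveLawEight` (E-p3-Q₈, `t = 8` at `4 ∣ N`) — NOTHING ASSERTED.

Contents (the row vocabulary `rowValid`, `rowMoves`, `rowSymbol` and the three EXACT invariances `rowSymbol_lower/upper/neg`
are the sibling file `…Theorems/ManinLocalTwoThreeRowSymbol.lean`): the ONE invariance modulo the loop span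
`rowSymbol_scale_sub_mem` — for a valid row `(c, d)` with `gcd(t, d) = 1`, `rowSymbol f (t c) d − rowSymbol f c d ∈
closure (degeneracyLoops f t)`: the two rows are the bottom rows of `h = (A B; tc d)` and of its `diag(t,1)`-conjugate
`θh = (A tB; c d)`, and by Manin's relation at `r = k` and at `r = tk` the difference `{∞, θh∞} − {∞, h∞}` equals
`{∞, t·(Ak+B)/(tck+d)} − {∞, (Ak+B)/(tck+d)}` for EVERY `k` (`loop_eq_cuspSymbol_sub`); Dirichlet's theorem (Mathlib
`Nat.forall_exists_prime_gt_and_zmodEq`) makes the denominator a prime `> tN`, i.e. a degeneracy loop;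
`rowSymbol_sub_mem_of_eqvGen` — hence `rowSymbol` is constant modulo the loop span on `EqvGen`-classes of row moves;
**`periodLatticeGamma1_le_closure_degeneracyLoops_of_rowMoves`** and **`closure_degeneracyLoops_eq_periodLatticeGamma1_of_rowMoves`**
— connectivity at `(N, t)` (hypothesis spelled out, no named predicate) ⟹ the law at `(N, t)` for every `f` (the bottom row
of `γ ∈ Γ₁(N)` is valid with `d ≡ 1`, and `rowSymbol f 0 1 = 0`); the typed rows `RowMoveLawNine` / `RowMoveLawEight` and
the edges **`degeneracyLoopLawNine_of_rowMoveLawNine : RowMoveLawNine → DegeneracyLoopLawNine`**,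
**`degeneracyLoopLawEight_of_rowMoveLawEight : RowMoveLawEight → DegeneracyLoopLawEight`**.

So E-es-68₉ / 68₈ are implied by an elementary connectivity law on `ℤ²`.  NUMERICS (seat p3 g10, in-seat breadth-first
search, < 60 s per level): connectivity verified for all valid rows with `d ≤ 100…170` at
`(N, t) ∈ {(9,9),(18,9),(27,9),(36,9),(45,9),(81,9),(4,8),(8,8),(12,8),(16,8),(20,8)}` (0 failures; the connecting paths
need excursions to height ≤ 10⁴); the control `t = 1` fails massively (218/312 rows at `N = 7`: the thin group `⟨T, u_N⟩`),
as it must.  `RowMoveLawNine/Eight` are NOT proved here and nothing is asserted about them: they are cell CANDIDATE LAWS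
(rows E-p3-Q₉ / E-p3-Q₈), the whole open content of E-es-68₉ / 68₈ isolated in elementary form.  BSD is not proved by this; Manin's
conjecture is not proved by this; C2/C3 stay OPEN.

References: K. Ribet, *Congruence relations between modular forms*, Proc. ICM 1983 (1984), Thm. 4.3 (the equaliser for
`t ∤ N`; shape only) [cite: Ribet1984ICM, Thm. 4.3 (shape only)]; Ju. I. Manin, Izv. 6 (1972), Prop. 1.4 / Thm. 1.6
(the relation `{∞, γr} = {∞, γ∞} + {∞, r}`) [cite: Manin1972, Prop. 1.4 / Thm. 1.6]; cell memo HOME/MEMO-es.md §31.17 (B)–(D).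
-/

set_option autoImplicit false
set_option linter.dupNamespace false

noncomputable section

open scoped Classical MatrixGroups ModularForm

open CongruenceSubgroup Matrix.SpecialLinearGroup
  Literature.NumberTheory.EllipticCurves Literature.NumberTheory.EllipticCurves.ModularForms
  Summit.BirchSwinnertonDyer.Rank1Residual.ManinAdditive.Gamma1Lattice

namespace Summit.BirchSwinnertonDyer.BirchSwinnertonDyer.Theorems.ManinLocalTwoThree

/-! ### §1. The two elementary rows (NOTHING ASSERTED) -/

section Moves

/-- **Row-move connectivity at `t = 9` (cell bsd-f2-manin candidate law E-p3-Q₉; NOTHING ASSERTED).**  At every level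
`9 ∣ N`, every valid row `(c, d)` with `d ≡ ±1 (mod N)` is joined to `(0, 1)` by a finite chain of row moves and inverse
row moves (`Relation.EqvGen` of `rowMoves N 9`).  A statement about `ℤ²` only; by
`degeneracyLoopLawNine_of_rowMoveLawNine` below it implies E-es-68₉ `DegeneracyLoopLawNine`.  In-seat census (p3 g10,
breadth-first search): true for every valid row of height `≤ 100…170` at `N ∈ {9, 18, 27, 36, 45, 81}`, 0 failures; the
control `t = 1` fails (thin group `⟨T, u_N⟩`).  Shape reference only: the equaliser it implies is Ribet's for `t ∤ N`.
[cite: Ribet1984ICM, Thm. 4.3 (shape only — the row-move form is the cell's row E-p3-Q₉, NOT in print)] -/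
@[conjecture]
def RowMoveLawNine : Prop :=
  ∀ N : ℕ, 3 ^ 2 ∣ N → ∀ c d : ℤ, (c, d) ∈ rowValid N → ((d : ZMod N) = 1 ∨ (d : ZMod N) = -1) →
    Relation.EqvGen (fun p q : ℤ × ℤ => (p, q) ∈ rowMoves N 9) (c, d) (0, 1)

/-- **Row-move connectivity at `t = 8` (cell bsd-f2-manin candidate law E-p3-Q₈; NOTHING ASSERTED).**  At every level
`4 ∣ N`, every valid row `(c, d)` with `d ≡ ±1 (mod N)` is joined to `(0, 1)` by a finite chain of row moves and inverse
row moves (`Relation.EqvGen` of `rowMoves N 8`); implies E-es-68₈ `DegeneracyLoopLawEight`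
(`degeneracyLoopLawEight_of_rowMoveLawEight`).  In-seat census: true for every valid row of height `≤ 60…70` at
`N ∈ {4, 8, 12, 16, 20}`, 0 failures.
[cite: Ribet1984ICM, Thm. 4.3 (shape only — the row-move form is the cell's row E-p3-Q₈, NOT in print)] -/
@[conjecture]
def RowMoveLawEight : Prop :=
  ∀ N : ℕ, 2 ^ 2 ∣ N → ∀ c d : ℤ, (c, d) ∈ rowValid N → ((d : ZMod N) = 1 ∨ (d : ZMod N) = -1) →
    Relation.EqvGen (fun p q : ℤ × ℤ => (p, q) ∈ rowMoves N 8) (c, d) (0, 1)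

end Moves

section RowSymbol

variable {N : ℕ} [NeZero N] (f : CuspForm (Gamma0 N) 2)

/-! ### §4. The scaling move modulo the degeneracy-loop span -/

/-- **Transport of a degeneracy loop along a matrix of `Γ₀(tN)`.**  For `h = (A B; tc d) ∈ Γ₀(N)` with `N ∣ c` and
its `diag(t,1)`-conjugate `θh = (A tB; c d) ∈ Γ₀(N)`: for every `k` with `tck + d ≠ 0`,
`{∞, t(Ak+B)/(tck+d)}_f − {∞, (Ak+B)/(tck+d)}_f = {∞, θh∞}_f − {∞, h∞}_f` (Manin's relation for `h` at `r = k` and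
for `θh` at `r = tk`, where `θh·(tk) = t·(h·k)`, plus `{∞, k} = {∞, tk} = {∞, 0}`). [cite: Manin1972, Prop. 1.4 / Thm. 1.6] -/
theorem loop_eq_cuspSymbol_sub (t : ℕ) {A B c d : ℤ} (hdet : A * d - B * (t * c) = 1)
    (hdet' : A * d - (t * B) * c = 1) (hc : (N : ℤ) ∣ c) (htc : (N : ℤ) ∣ t * c)
    (k : ℤ) (hk : (t : ℤ) * c * k + d ≠ 0) :
    modularSymbol f ((t : ℚ) * ((A * k + B : ℤ) : ℚ) / (((t : ℤ) * c * k + d : ℤ) : ℚ)) -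
        modularSymbol f (((A * k + B : ℤ) : ℚ) / (((t : ℤ) * c * k + d : ℤ) : ℚ)) =
      cuspSymbol f (gamma0Of A (t * B) c d hdet' hc) - cuspSymbol f (gamma0Of A B (t * c) d hdet htc) := by
  obtain ⟨h00, h01, h10, h11⟩ := gamma0Of_apply (N := N) A B (t * c) d hdet htc
  obtain ⟨g00, g01, g10, g11⟩ := gamma0Of_apply (N := N) A (t * B) c d hdet' hc
  have hkQ : ((t : ℚ) * c * k + d) ≠ 0 := by exact_mod_cast hk
  -- Manin relation for `h` at `r = k`
  have hne₁ : (((gamma0Of A B (t * c) d hdet htc : Gamma0 N) : SL(2, ℤ)) 1 0 : ℤ) * (k : ℚ) +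
      (((gamma0Of A B (t * c) d hdet htc : Gamma0 N) : SL(2, ℤ)) 1 1 : ℤ) ≠ 0 := by
    rw [h10, h11]; push_cast; exact hkQ
  have key₁ := modularSymbol_gamma0_smul_holds f (gamma0Of A B (t * c) d hdet htc) (k : ℚ) hne₁
  rw [h00, h01, h10, h11] at key₁
  -- Manin relation for `θh` at `r = t k`
  have hne₂ : (((gamma0Of A (t * B) c d hdet' hc : Gamma0 N) : SL(2, ℤ)) 1 0 : ℤ) * ((t : ℚ) * k) +
      (((gamma0Of A (t * B) c d hdet' hc : Gamma0 N) : SL(2, ℤ)) 1 1 : ℤ) ≠ 0 := by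
    rw [g10, g11]
    have : ((c : ℤ) : ℚ) * ((t : ℚ) * k) + ((d : ℤ) : ℚ) = (t : ℚ) * c * k + d := by ring
    rw [this]; exact hkQ
  have key₂ := modularSymbol_gamma0_smul_holds f (gamma0Of A (t * B) c d hdet' hc) ((t : ℚ) * k) hne₂
  rw [g00, g01, g10, g11] at key₂
  have hint : ∀ n : ℤ, modularSymbol f (n : ℚ) = modularSymbol f 0 := by
    intro n; have := modularSymbol_add_intCast_holds f 0 n; rwa [zero_add] at this
  have e₁ : (((A : ℤ) : ℚ) * (k : ℚ) + ((B : ℤ) : ℚ)) / ((((t : ℤ) * c : ℤ) : ℚ) * (k : ℚ) + ((d : ℤ) : ℚ)) =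
      ((A * k + B : ℤ) : ℚ) / (((t : ℤ) * c * k + d : ℤ) : ℚ) := by
    push_cast; ring_nf
  have e₂ : (((A : ℤ) : ℚ) * ((t : ℚ) * k) + (((t : ℤ) * B : ℤ) : ℚ)) /
        (((c : ℤ) : ℚ) * ((t : ℚ) * k) + ((d : ℤ) : ℚ)) =
      (t : ℚ) * ((A * k + B : ℤ) : ℚ) / (((t : ℤ) * c * k + d : ℤ) : ℚ) := by
    push_cast; ring_nf
  have htk : ((t : ℚ) * k) = (((t : ℤ) * k : ℤ) : ℚ) := by push_cast; ring
  rw [e₁, hint k] at key₁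
  rw [e₂, htk, hint ((t : ℤ) * k)] at key₂
  rw [key₁, key₂]
  ring

/-- **The scaling move modulo the loop span.**  For a valid row `(c, d)` (`N ∣ c`) with `gcd(t, d) = 1` and `t ≥ 1`:
`rowSymbol f (t c) d − rowSymbol f c d ∈ closure (degeneracyLoops f t)`.  The rows are the bottom rows of
`h = (A B; tc d)` and `θh = (A tB; c d)` (choose `B` with `t B ≡ b (mod d)`); by `loop_eq_cuspSymbol_sub` the difference
of periods is the `t`-loop at `(Ak+B)/(tck+d)` for every `k`, and Dirichlet's theorem
(`Nat.forall_exists_prime_gt_and_zmodEq` on `d + tc·ℤ`) makes the denominator a prime `> tN`. [cite: Manin1972, Prop. 1.4 / Thm. 1.6] -/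
theorem rowSymbol_scale_sub_mem {t : ℕ} (ht : 0 < t) {c d : ℤ} (h : (c, d) ∈ rowValid N)
    (htd : IsCoprime (t : ℤ) d) :
    rowSymbol f (t * c) d - rowSymbol f c d ∈ AddSubgroup.closure (degeneracyLoops f t) := by
  obtain ⟨hNc, hcd⟩ := mem_rowValid.mp h
  by_cases hc0 : c = 0
  · subst hc0
    rw [mul_zero, sub_self]
    exact zero_mem _
  -- a matrix `(a b; c d)` and the adjustment `B` with `b + j d = t B`
  obtain ⟨u₀, v₀, huv⟩ := hcd            -- u₀ c + v₀ d = 1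
  obtain ⟨u, v, htuv⟩ := htd             -- u t + v d = 1
  have hdet₀ : v₀ * d - (-u₀) * c = 1 := by linear_combination huv
  have hbj : (-u₀) + (u₀ * v) * d = t * (-u₀ * u) := by linear_combination u₀ * htuv
  have hdet : (v₀ + (u₀ * v) * c) * d - (-u₀ * u) * (t * c) = 1 := by
    linear_combination hdet₀ + c * hbj
  have hdet' : (v₀ + (u₀ * v) * c) * d - (t * (-u₀ * u)) * c = 1 := by linear_combination hdet
  have htc : (N : ℤ) ∣ t * c := Dvd.dvd.mul_left hNc _
  -- the two rows as explicit matrices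
  have hrow₁ : rowSymbol f (t * c) d =
      cuspSymbol f (gamma0Of (v₀ + (u₀ * v) * c) (-u₀ * u) (t * c) d hdet htc) :=
    rowSymbol_eq_cuspSymbol_gamma0Of f _ _ (t * c) d hdet htc
  have hrow₂ : rowSymbol f c d =
      cuspSymbol f (gamma0Of (v₀ + (u₀ * v) * c) (t * (-u₀ * u)) c d hdet' hNc) :=
    rowSymbol_eq_cuspSymbol_gamma0Of f _ _ c d hdet' hNc
  -- Dirichlet: a prime `ℓ = t c k + d > tN`
  have hC0 : (t : ℤ) * c ≠ 0 := mul_ne_zero (by exact_mod_cast ht.ne') hc0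
  have hcopdC : IsCoprime d ((t : ℤ) * c) :=
    ⟨v₀ + (u₀ * v) * c, -(-u₀ * u), by linear_combination hdet⟩
  have hq0 : ((t : ℤ) * c).natAbs ≠ 0 := Int.natAbs_ne_zero.mpr hC0
  have hqZ : ((((t : ℤ) * c).natAbs : ℕ) : ℤ) = t * c ∨ ((((t : ℤ) * c).natAbs : ℕ) : ℤ) = -(t * c) := by
    rcases Int.natAbs_eq ((t : ℤ) * c) with h | h
    · left; exact h.symm
    · right; linarith
  have hcopq : IsCoprime d ((((t : ℤ) * c).natAbs : ℕ) : ℤ) := by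
    rcases hqZ with h | h
    · rw [h]; exact hcopdC
    · rw [h]; exact hcopdC.neg_right
  obtain ⟨ℓ, hℓn, hℓp, hℓd⟩ := Nat.forall_exists_prime_gt_and_zmodEq (t * N) hq0 hcopq
  obtain ⟨k, hk⟩ : ∃ k : ℤ, (ℓ : ℤ) = t * c * k + d := by
    obtain ⟨s, hs⟩ := (Int.modEq_iff_dvd.mp hℓd)
    rcases hqZ with h | h
    · exact ⟨-s, by rw [h] at hs; linear_combination -hs⟩
    · exact ⟨s, by rw [h] at hs; linear_combination -hs⟩
  have hℓ0 : (ℓ : ℤ) ≠ 0 := by exact_mod_cast hℓp.ne_zero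
  have hℓpos : (0 : ℤ) < ℓ := by exact_mod_cast hℓp.pos
  have hkne : (t : ℤ) * c * k + d ≠ 0 := by rw [← hk]; exact hℓ0
  -- the loop at `(A k + B)/ℓ` is the difference of the two periods
  have hloop := loop_eq_cuspSymbol_sub f t hdet hdet' hNc htc k hkne
  -- normalise the numerator to a natural number `b₁ < ℓ`
  have hcopn : IsCoprime ((v₀ + (u₀ * v) * c) * k + (-u₀ * u)) (ℓ : ℤ) := by
    refine ⟨-(t * c), v₀ + (u₀ * v) * c, ?_⟩
    rw [hk]
    linear_combination hdet
  have hb₀nn : 0 ≤ ((v₀ + (u₀ * v) * c) * k + (-u₀ * u)) % ℓ := Int.emod_nonneg _ hℓ0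
  have hndiv : (v₀ + (u₀ * v) * c) * k + (-u₀ * u) =
      ((v₀ + (u₀ * v) * c) * k + (-u₀ * u)) % ℓ + ℓ * (((v₀ + (u₀ * v) * c) * k + (-u₀ * u)) / ℓ) :=
    (Int.emod_add_mul_ediv _ _).symm
  set b₁ : ℕ := (((v₀ + (u₀ * v) * c) * k + (-u₀ * u)) % ℓ).toNat with hb₁
  set q₀ : ℤ := ((v₀ + (u₀ * v) * c) * k + (-u₀ * u)) / ℓ with hq₀
  have hb₁Z : (b₁ : ℤ) = ((v₀ + (u₀ * v) * c) * k + (-u₀ * u)) % ℓ := Int.toNat_of_nonneg hb₀nn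
  have hnum : (v₀ + (u₀ * v) * c) * k + (-u₀ * u) = (b₁ : ℤ) + ℓ * q₀ := by rw [hb₁Z]; exact hndiv
  have hℓb₁ : ¬ ℓ ∣ b₁ := by
    intro hdiv
    have hdivZ : (ℓ : ℤ) ∣ (v₀ + (u₀ * v) * c) * k + (-u₀ * u) := by
      rw [hnum]
      exact dvd_add (by exact_mod_cast hdiv) (Dvd.intro _ rfl)
    have hunit : IsUnit (ℓ : ℤ) := hcopn.isUnit_of_dvd' hdivZ (dvd_refl _)
    rcases Int.isUnit_iff.mp hunit with h1 | h1
    · exact hℓp.one_lt.ne' (by exact_mod_cast h1)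
    · linarith
  have hℓtN : ¬ ℓ ∣ t * N :=
    fun hdiv => absurd (Nat.le_of_dvd (Nat.mul_pos ht (Nat.pos_of_ne_zero (NeZero.ne N))) hdiv)
      (not_le.mpr hℓn)
  have hmem : modularSymbol f (((t * b₁ : ℕ) : ℚ) / ℓ) - modularSymbol f ((b₁ : ℚ) / ℓ) ∈
      degeneracyLoops f t := ⟨ℓ, b₁, hℓp, hℓtN, hℓb₁, rfl⟩
  -- periodicity: the loop at `(A k + B)/ℓ` is the loop at `b₁/ℓ`
  have hℓQ : (ℓ : ℚ) ≠ 0 := by exact_mod_cast hℓp.ne_zero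
  have hden : (((t : ℤ) * c * k + d : ℤ) : ℚ) = (ℓ : ℚ) := by
    rw [← hk]; push_cast; rfl
  have hnumQ : ((((v₀ + (u₀ * v) * c) * k + (-u₀ * u) : ℤ)) : ℚ) = (b₁ : ℚ) + (ℓ : ℚ) * (q₀ : ℚ) := by
    exact_mod_cast hnum
  have e₁ : ((((v₀ + (u₀ * v) * c) * k + (-u₀ * u) : ℤ)) : ℚ) / (((t : ℤ) * c * k + d : ℤ) : ℚ) =
      (b₁ : ℚ) / ℓ + ((q₀ : ℤ) : ℚ) := by
    rw [hden, hnumQ]; field_simp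
  have e₂ : (t : ℚ) * ((((v₀ + (u₀ * v) * c) * k + (-u₀ * u) : ℤ)) : ℚ) / (((t : ℤ) * c * k + d : ℤ) : ℚ) =
      ((t * b₁ : ℕ) : ℚ) / ℓ + (((t : ℤ) * q₀ : ℤ) : ℚ) := by
    rw [hden, hnumQ]; push_cast; field_simp
  rw [e₁, e₂, modularSymbol_add_intCast_holds f, modularSymbol_add_intCast_holds f] at hloop
  -- conclude
  rw [hrow₁, hrow₂, ← neg_sub, ← hloop]
  exact neg_mem (AddSubgroup.subset_closure hmem)

/-! ### §5. Invariance along chains of moves; the reduction -/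

/-- **`rowSymbol` is constant modulo the loop span on `EqvGen`-classes of row moves** (`t ≥ 1`). [folklore] -/
theorem rowSymbol_sub_mem_of_eqvGen {t : ℕ} (ht : 0 < t) {p q : ℤ × ℤ}
    (hpq : Relation.EqvGen (fun p q : ℤ × ℤ => (p, q) ∈ rowMoves N t) p q) :
    rowSymbol f p.1 p.2 - rowSymbol f q.1 q.2 ∈ AddSubgroup.closure (degeneracyLoops f t) := by
  induction hpq with
  | rel x y hxy =>
      obtain ⟨hx, hy, hmv⟩ := mem_rowMoves.mp hxy
      rcases hmv with ⟨k, rfl⟩ | ⟨k, rfl⟩ | rfl | hx'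
      · rw [rowSymbol_lower f hx k, sub_self]; exact zero_mem _
      · rw [rowSymbol_upper f hx k, sub_self]; exact zero_mem _
      · rw [rowSymbol_neg f hx, sub_self]; exact zero_mem _
      · subst hx'
        exact rowSymbol_scale_sub_mem f ht hy (mem_rowValid.mp hx).2.of_mul_left_left
  | refl x => rw [sub_self]; exact zero_mem _
  | symm x y _ ih =>
      have := neg_mem ih
      rwa [neg_sub] at this
  | trans x y z _ _ ih₁ ih₂ =>
      have := add_mem ih₁ ih₂
      rwa [sub_add_sub_cancel] at this

/-- **Row-move connectivity at `(N, t)` ⟹ `Λ₁(f) ≤ closure (degeneracyLoops f t)`** for every `f ∈ S₂(Γ₀(N))` (`t ≥ 1`):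
the bottom row `(c, d)` of `γ ∈ Γ₁(N)` is valid with `d ≡ 1 (mod N)`, so `{∞, γ∞}_f = rowSymbol f c d ≡ rowSymbol f 0 1 = 0`
modulo the loop span.  The connectivity hypothesis is spelled out (no named predicate). [cite: Manin1972, Prop. 1.4 / Thm. 1.6] -/
theorem periodLatticeGamma1_le_closure_degeneracyLoops_of_rowMoves {t : ℕ} (ht : 0 < t)
    (hQ : ∀ c d : ℤ, (c, d) ∈ rowValid N → ((d : ZMod N) = 1 ∨ (d : ZMod N) = -1) →
      Relation.EqvGen (fun p q : ℤ × ℤ => (p, q) ∈ rowMoves N t) (c, d) (0, 1)) :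
    periodLatticeGamma1 f ≤ AddSubgroup.closure (degeneracyLoops f t) := by
  unfold periodLatticeGamma1
  refine (AddSubgroup.closure_le _).mpr ?_
  rintro _ ⟨γ, rfl⟩
  have hγ1 := (Gamma1_mem N (γ : SL(2, ℤ))).mp γ.2
  set δ : Gamma0 N := ⟨(γ : SL(2, ℤ)), Gamma1_in_Gamma0 N γ.2⟩ with hδ
  have hdet : ((δ : SL(2, ℤ)) 0 0 : ℤ) * (δ : SL(2, ℤ)) 1 1 - ((δ : SL(2, ℤ)) 0 1 : ℤ) * (δ : SL(2, ℤ)) 1 0 = 1 := by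
    have := Matrix.det_fin_two ((δ : SL(2, ℤ)) : Matrix (Fin 2) (Fin 2) ℤ)
    rw [(δ : SL(2, ℤ)).2] at this
    exact this.symm
  have hvalid : (((δ : SL(2, ℤ)) 1 0 : ℤ), ((δ : SL(2, ℤ)) 1 1 : ℤ)) ∈ rowValid N := by
    refine mem_rowValid.mpr ⟨(ZMod.intCast_zmod_eq_zero_iff_dvd _ N).mp hγ1.2.2, ?_⟩
    exact ⟨-((δ : SL(2, ℤ)) 0 1 : ℤ), ((δ : SL(2, ℤ)) 0 0 : ℤ), by linear_combination hdet⟩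
  have hd1 : ((((δ : SL(2, ℤ)) 1 1 : ℤ) : ZMod N) = 1 ∨ (((δ : SL(2, ℤ)) 1 1 : ℤ) : ZMod N) = -1) :=
    Or.inl hγ1.2.1
  have key := rowSymbol_sub_mem_of_eqvGen f ht (hQ _ _ hvalid hd1)
  simp only at key
  rwa [rowSymbol_zero_one, sub_zero, rowSymbol_eq_cuspSymbol] at key

/-- **Row-move connectivity at `(N, t)` ⟹ the degeneracy-loop law at `(N, t)`**: `closure (degeneracyLoops f t) = Λ₁(f)`
for every `f ∈ S₂(Γ₀(N))` (`t ≥ 1`; the easy half is the tree's `closure_degeneracyLoops_le`). [cite: Ribet1984ICM, Thm. 4.3 (shape only)] -/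
theorem closure_degeneracyLoops_eq_periodLatticeGamma1_of_rowMoves {t : ℕ} (ht : 0 < t)
    (hQ : ∀ c d : ℤ, (c, d) ∈ rowValid N → ((d : ZMod N) = 1 ∨ (d : ZMod N) = -1) →
      Relation.EqvGen (fun p q : ℤ × ℤ => (p, q) ∈ rowMoves N t) (c, d) (0, 1)) :
    AddSubgroup.closure (degeneracyLoops f t) = periodLatticeGamma1 f :=
  le_antisymm (closure_degeneracyLoops_le f t)
    (periodLatticeGamma1_le_closure_degeneracyLoops_of_rowMoves f ht hQ)

end RowSymbol

/-! ### §6. The two named rows E-es-68₉ / E-es-68₈ -/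

/-- **E-es-68₉ ⟸ E-p3-Q₉**: row-move connectivity at `t = 9` implies `DegeneracyLoopLawNine`. [cite: Ribet1984ICM, Thm. 4.3 (shape only)] -/
theorem degeneracyLoopLawNine_of_rowMoveLawNine (h : RowMoveLawNine) : DegeneracyLoopLawNine := by
  intro N _ h9 f
  exact closure_degeneracyLoops_eq_periodLatticeGamma1_of_rowMoves f (by norm_num) (h N h9)

/-- **E-es-68₈ ⟸ E-p3-Q₈**: row-move connectivity at `t = 8` implies `DegeneracyLoopLawEight`. [cite: Ribet1984ICM, Thm. 4.3 (shape only)] -/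
theorem degeneracyLoopLawEight_of_rowMoveLawEight (h : RowMoveLawEight) : DegeneracyLoopLawEight := by
  intro N _ h4 f
  exact closure_degeneracyLoops_eq_periodLatticeGamma1_of_rowMoves f (by norm_num) (h N h4)

end Summit.BirchSwinnertonDyer.BirchSwinnertonDyer.Theorems.ManinLocalTwoThree

end
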